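import Summits.QuantumFields.YangMills.Theorems.BalabanUVNodesN07ChartDDecayRefBond
import Summits.QuantumFields.YangMills.Theorems.BalabanUVNodesK0Stub1ChartDAnalytic
import HarnessLib

/-!
# BalabanUVNodes ∕ N07 — THE DECAY PACKAGE OF RECORD IN ITS ANALYTIC EDITION: ONE `(H, Dfun)` carrying (73)'s kernel-entry decay AND the second-order holomorphy of the
# true chart `D(·)` (the (46) letter of the SAME `H` exported; `Dfun` of class `C^ω` with `fderiv ℂ Dfun` holomorphic on the weighted ball)

Cell `pub-ymgap`, width seat `pub-ymgap-dag-n07-w2` generation 5 (HUMAN RULING D-0149; DAG node N07 = [15] = [Balaban1985Variational]; W-SEAT START LIST §n07 item 2 = S2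
«[15] Sect. C (47)–(49), Prop. 3 at objects»).  `--kind proof --supports stmt-QuantumFields-27364 --as helper` (K1⁹ face per KEY MAP v2; count-neutral).  CONSUMED BY NAME,
nothing modified: this seat's `N07ChartHInvTwisted.exists_rightInverse_chartLog_twisted` (the route's right inverse `H` of `D chartLog(0)` from P2's kernel rows, with the
weighted sup letter AND all twisted letters), `N07ChartDDerivative.exists_chartD_hasFDerivAt` ((55), (49), (48), Fréchet derivative, norm-level (73)), `N07ChartDOfRecord.size_chartA_le`
((57)), `N07ChartDDecay.chartD_fderiv_twisted_le` ((73) in weight-conjugation form), `N07ChartDDecayAtRecord.kernelRowsAt_of_adm22_T4` (P2's rows on NODE 00's four-tori),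
`N07ChartDDecayRefBond.refTwist_*` (the four slacks of the canonical twist «scaled distance to a reference fine bond»); dag k0-s1-w2's
`K0Stub1ChartDAnalytic.{contDiffOn_chartD, differentiableOn_fderiv_chartD}` (EVERY solution family of (49) with the (55) bound is `C^ω` on the ball, implicit function theorem in
class `ω`; it needs the (46) letter of the right inverse `H` that enters (49)).

WHY THIS FILE.  The g4 decay package (`N07ChartHInvTwisted.exists_chartD_decay_of_kernelRows` → `N07ChartDDecayAtRecord.exists_chartD_decay_T4` →
`N07ChartDDecayRefBond.exists_chartD_kernelEntry_decay_T4`) exports its `H` only through `D chartLog(0)∘H = id` — the (46) letter `w₁(b)‖HX(b)‖ ≤ B₀′‖X‖_∞` stayed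
proof-internal; the g3 analytic package (`N07Prop3AtRecordAnalytic.exists_prop3_T4_analytic`) is a DIFFERENT existential `(H, Dfun)`.  Since the chart (47) depends on the choice
of `H` («there are many linearizing transformations», p. 287), a consumer needing BOTH the kernel decay of `𝔇 = δD∕δA′` AND the holomorphy of `A′ ↦ 𝔇(A′)` (the p. 289 remark on
`𝔇₂`, Sect. D's (85)–(86)) needs them for ONE `Dfun`.  This file re-runs the g4 chain exporting the letter and feeds it to k0-s1-w2's analyticity theorem.

WHAT IS PROVED (sorry-free; no definition; axioms standard).
§1 ★★ `exists_chartD_decay_of_kernelRows_analytic` — generic carrier `P`, binders of `exists_chartD_decay_of_kernelRows` VERBATIM; conclusion = that theorem's conjuncts ∧ the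
   (46) letter of the same `H` (`B₀′ = C_KB₃(1+2C)(1+2C(1+L))`, `C = (d+2)L`) ∧ `ContDiffOn ℂ ω Dfun` ∧ `DifferentiableOn ℂ (fderiv ℂ Dfun)` on the weighted `ε`-ball.
§2 ★★ `exists_chartD_decay_T4_analytic` — the record edition for every admissible twist (= `exists_chartD_decay_T4` + the three conjuncts).
§3 ★★★ `exists_chartD_kernelEntry_decay_T4_analytic` — the record edition in print's kernel shape (= `exists_chartD_kernelEntry_decay_T4` + the three conjuncts):
   `‖𝔇(δ_b·a)(j,c)‖ ≤ 4C₃ε·e^{2δ}·w₁(b)‖a‖·e^{−δ·distBI D b (j,c)}` at EVERY point of the ball, for a `Dfun` whose `fderiv` is holomorphic there.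

HONEST FRAMING: count-neutral helper; a re-run of this seat's own g4 compositions BY NAME with one proof-internal letter exported, plus k0-s1-w2's theorem BY NAME — NO new
estimate; (58), the ∇-row and [15] Sects. D–F NOT here; stub 1 ∕ K0⁷ ∕ K1⁹ NOT closed; N07 NOT discharged; counts unmoved; one finite T⁴ programme at fixed ε — NOT continuum ∕
ℝ⁴ ∕ OS ∕ mass gap ∕ Clay: the Yang–Mills mass gap is NOT proved by any of this; R4 closes the conditional rung `BalabanLadder.UV` only.  No `sorry`, no `def`, no `instance`,
no `notation`.

References: [15] T. Bałaban, CMP 102 (1985) 277–309 [Balaban1985Variational] ((45)–(57) pp.285–287, (63)–(73) pp.287–289, Prop. 3 + remark p.289, (85)–(86) p.291,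
(161)–(162) p.303); [3] = [B6] CMP 96 (1984) 223–250 [Balaban1984PropagatorsII] (Lemma 2.1 p.232, (2.46) p.231, (2.54) p.233, Cor. 2.8 (2.150)–(2.151) p.249); [I] CMP 109
(1987) 249–301 [Balaban1987RG1] ((0.1) p.251, (0.4) p.253).
-/

noncomputable section

open scoped BigOperators Matrix.Norms.L2Operator ContDiff
open NormedSpace Metric Set

namespace Summit.QuantumFields.YangMills.BalabanUVNodes.N07ChartDDecayAnalytic

open Literature.MathematicalPhysics.QuantumFieldTheory.Balaban1983to89
open Literature.MathematicalPhysics.QuantumFieldTheory.Balaban1983to89.T4Continuum (T4Family)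
open B5Eq118OneStroke (iterBlockOf)
open B5Eq117TorusCarriers (Mk)
open B5Prop12FieldsLattice (distSite distSite_self)
open B6SectADomainsV1 (Domains)
open B6SectAOperatorsV1 (BondIdx)
open Summit.QuantumFields.YangMills.Theorems.FlatCubeOpsText (Adm22 distBI)
open Summit.QuantumFields.YangMills.Theorems.K0FlatCubeOpsTextP (IsFlatH IsLevWeight HKernelRows RowSum162 flatH isFlatH_flatH levWeight_nonneg)
open Summit.QuantumFields.YangMills.Theorems.HalvingQuarterCubeSeq (distBI_nonneg)
open Summit.QuantumFields.YangMills.Theorems.Prop8Chart (chartLog collar_of_adm22)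
open Summit.QuantumFields.YangMills.Theorems.K0Stub1ChartDAnalytic (contDiffOn_chartD differentiableOn_fderiv_chartD)
open Summit.QuantumFields.YangMills.BalabanUVNodes.N07ChartDDecay (chartD_fderiv_twisted_le)
open Summit.QuantumFields.YangMills.BalabanUVNodes.N07ChartDDerivative (exists_chartD_hasFDerivAt)
open Summit.QuantumFields.YangMills.BalabanUVNodes.N07ChartDOfRecord (size_chartA_le)
open Summit.QuantumFields.YangMills.BalabanUVNodes.N07ChartHInvTwisted (exists_rightInverse_chartLog_twisted)
open Summit.QuantumFields.YangMills.BalabanUVNodes.N07ChartDDecayAtRecord (kernelRowsAt_of_adm22_T4)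
open Summit.QuantumFields.YangMills.BalabanUVNodes.N07ChartDDecayRefBond (refTwist_triangle refTwist_index_slack refTwist_block_slack refTwist_read_slack)

variable {P : Params} {n : Type*} [Fintype n] [DecidableEq n] [Nonempty n]

/-! ## §1 Generic carrier: the decay package with the (46) letter of its `H` exported and `Dfun` of class `C^ω`, `fderiv ℂ Dfun` holomorphic -/

/-- ★★ **[15] PROPOSITION 3 WITH (73)'s DECAY FROM P2's KERNEL ROWS — ANALYTIC EDITION, generic carrier.**  Binders of `N07ChartHInvTwisted.exists_chartD_decay_of_kernelRows`
verbatim (nested family `D`, `D.k = k`, `Adm22 D R′ M`, `2L ≤ R′`, `1 ≤ M`; level weights `w`; the pinned flat `H₀` with P2's `HKernelRows` ∕ `RowSum162` over `dBI ≥ 0`; the window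
`18C₂B₀′ε ≤ 1`, `64ε ≤ R⋆`).  Conclusion: the route's right inverse `H` of `D chartLog(0)` WITH ITS WEIGHTED (46) LETTER `w₁(b)‖HX(b)‖ ≤ B₀′·t` (`B₀′ = C_KB₃(1+2C)(1+2C(1+L))`,
`C = (d+2)L`), and the chart map `Dfun`: `DifferentiableOn`, **`ContDiffOn ℂ ω`**, **`DifferentiableOn ℂ (fderiv ℂ Dfun)`** on the weighted `ε`-ball, and at every point of the
ball (55), (49), (48), a Fréchet derivative `𝔇` with the norm-level (73) and, for every admissible twist pair, the twisted (73). [cite: Balaban1985Variational, (45)-(57) pp.285-287, (68)-(73) pp.288-289, Prop. 3 + remark p.289, Prop. 4 p.292; Balaban1984PropagatorsII, Lemma 2.1 p.232, Cor. 2.8 (2.150)-(2.151) p.249] -/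
theorem exists_chartD_decay_of_kernelRows_analytic (k : ℕ) {R' M : ℕ} (hR'L : 2 * P.L ≤ R') (hM : 1 ≤ M) (D : Domains P) (hDk : D.k = k)
    (hAdm : Adm22 D R' M) {w : ℕ → PBond P 0 → ℝ} (hw : IsLevWeight P k D w) (H₀ : (BondIdx D → ℝ) →ₗ[ℝ] (PBond P 0 → ℝ)) (hH₀ : IsFlatH P k D H₀)
    (dBI : PBond P 0 → BondIdx D → ℝ) (hd0 : ∀ b c, 0 ≤ dBI b c) {CK δ₀ B₃ : ℝ} (hCK : 0 ≤ CK) (hδ₀ : 0 ≤ δ₀) (hB₃ : 0 ≤ B₃)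
    (hker : HKernelRows P k D dBI w H₀ CK δ₀) (h162 : RowSum162 P k D dBI w δ₀ B₃) {ε : ℝ} (hε : 0 < ε)
    (h18 : 18 * (960 * (((P.d + 2) * P.L : ℕ) : ℝ) * (P.L : ℝ) / (12800 * (((P.d + 2) * P.L : ℕ) : ℝ) ^ 2 * (P.L : ℝ))⁻¹) *
      (CK * B₃ * (1 + 2 * ((P.d + 2) * P.L : ℕ)) * (1 + 2 * ((P.d + 2) * P.L : ℕ) * (1 + P.L))) * ε ≤ 1)
    (h2 : 64 * ε ≤ (12800 * (((P.d + 2) * P.L : ℕ) : ℝ) ^ 2 * (P.L : ℝ))⁻¹) :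
    let η : ℝ := ((P.L : ℝ)⁻¹) ^ k
    let Rs : ℝ := (12800 * (((P.d + 2) * P.L : ℕ) : ℝ) ^ 2 * (P.L : ℝ))⁻¹
    let C₂ : ℝ := 960 * (((P.d + 2) * P.L : ℕ) : ℝ) * (P.L : ℝ) / Rs
    let C₃ : ℝ := 3840 * (((P.d + 2) * P.L : ℕ) : ℝ) * (P.L : ℝ) / Rs
    let Qlin := (fderiv ℂ (chartLog η D : (PBond P 0 → Matrix n n ℂ) → BondIdx D → Matrix n n ℂ) 0)
    ∃ (H : (BondIdx D → Matrix n n ℂ) →ₗ[ℂ] (PBond P 0 → Matrix n n ℂ)) (Dfun : (PBond P 0 → Matrix n n ℂ) → (BondIdx D → Matrix n n ℂ)),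
      (∀ X, Qlin (H X) = X) ∧
      (∀ (X : BondIdx D → Matrix n n ℂ) (t : ℝ), 0 ≤ t → (∀ i, ‖X i‖ ≤ t) → ∀ b,
        w 1 b * ‖H X b‖ ≤ CK * B₃ * (1 + 2 * ((P.d + 2) * P.L : ℕ)) * (1 + 2 * ((P.d + 2) * P.L : ℕ) * (1 + P.L)) * t) ∧
      DifferentiableOn ℂ Dfun {A' : PBond P 0 → Matrix n n ℂ | ∀ b, w 1 b * ‖A' b‖ < ε} ∧
      ContDiffOn ℂ ω Dfun {A' : PBond P 0 → Matrix n n ℂ | ∀ b, w 1 b * ‖A' b‖ < ε} ∧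
      DifferentiableOn ℂ (fderiv ℂ Dfun) {A' : PBond P 0 → Matrix n n ℂ | ∀ b, w 1 b * ‖A' b‖ < ε} ∧
      ∀ A' : PBond P 0 → Matrix n n ℂ, (∀ b, w 1 b * ‖A' b‖ < ε) →
        (∀ (ρ : ℝ), 0 ≤ ρ → (∀ b, w 1 b * ‖A' b‖ ≤ ρ) → ∀ i, ‖Dfun A' i‖ ≤ 4 * C₂ * ρ ^ 2) ∧
        chartLog η D (A' - H (Dfun A')) - Qlin (A' - H (Dfun A')) = Dfun A' ∧
        chartLog η D (A' - H (Dfun A')) = Qlin A' ∧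
        ∃ 𝔇 : (PBond P 0 → Matrix n n ℂ) →L[ℂ] (BondIdx D → Matrix n n ℂ), HasFDerivAt Dfun 𝔇 A' ∧
          (∀ (W : PBond P 0 → Matrix n n ℂ) (t : ℝ), 0 ≤ t → (∀ b, w 1 b * ‖W b‖ ≤ t) → ∀ i, ‖𝔇 W i‖ ≤ 4 * C₃ * ε * t) ∧
          ∀ (dE : PBond P 0 → ℝ) (dF : BondIdx D → ℝ) (δ r₀ r₁ r₂ : ℝ), 0 ≤ δ → δ ≤ δ₀ / 2 →
            (∀ b c, dE b ≤ dBI b c + dF c) →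
            (∀ (i c : BondIdx D) (x : Site P 0),
              (iterBlockOf (i.1.1 : ℕ) x = i.1.2.src ∨ iterBlockOf (i.1.1 : ℕ) x = i.1.2.tgt) →
              (iterBlockOf (c.1.1 : ℕ) x = c.1.2.src ∨ iterBlockOf (c.1.1 : ℕ) x = c.1.2.tgt) → dF i ≤ dF c + r₁) →
            (∀ (b b' : PBond P 0) (x : Site P 0) (j : ℕ), (x = b.src ∨ x = b.tgt) → j ≤ D.k →
              iterBlockOf j b'.src = iterBlockOf j x → dE b ≤ dE b' + r₂) →
            (∀ (idx : BondIdx D) (b : PBond P 0),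
              (iterBlockOf (idx.1.1 : ℕ) b.src = idx.1.2.src ∨ iterBlockOf (idx.1.1 : ℕ) b.src = idx.1.2.tgt) →
              (iterBlockOf (idx.1.1 : ℕ) b.tgt = idx.1.2.src ∨ iterBlockOf (idx.1.1 : ℕ) b.tgt = idx.1.2.tgt) → dF idx ≤ dE b + r₀) →
            4 * C₃ * Real.exp (δ * r₀) *
                (CK * B₃ * (1 + 2 * ((P.d + 2) * P.L : ℕ) * Real.exp (δ * r₁)) * (1 + 2 * ((P.d + 2) * P.L : ℕ) * (1 + P.L) * Real.exp (δ * r₂))) * ε ≤ 1 →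
            ∀ (W : PBond P 0 → Matrix n n ℂ) (t : ℝ), 0 ≤ t → (∀ b, Real.exp (δ * dE b) * (w 1 b * ‖W b‖) ≤ t) →
              ∀ i, Real.exp (δ * dF i) * ‖𝔇 W i‖ ≤ 4 * C₃ * Real.exp (δ * r₀) * ε * t := by
  intro η Rs C₂ C₃ Qlin
  have hL0 : (0 : ℝ) < P.L := by exact_mod_cast P.L_pos
  have hℓ1 : (1 : ℝ) ≤ (((P.d + 2) * P.L : ℕ) : ℝ) := by
    exact_mod_cast Nat.one_le_iff_ne_zero.mpr (Nat.mul_ne_zero (by omega) (by have := P.hL.2; omega))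
  have hden : 0 < 12800 * (((P.d + 2) * P.L : ℕ) : ℝ) ^ 2 * (P.L : ℝ) := by positivity
  have hRs0 : 0 < Rs := inv_pos.mpr hden
  have hC₂ : 0 ≤ C₂ := by show 0 ≤ 960 * (((P.d + 2) * P.L : ℕ) : ℝ) * (P.L : ℝ) / Rs; positivity
  have hwpos : ∀ b, 0 < w 1 b := fun b => by rw [hw 1 b, pow_one]; positivity
  have hRM : 2 * P.L ≤ R' * M + 1 := by have : R' ≤ R' * M := Nat.le_mul_of_pos_right R' hM; omega
  have hcollar := collar_of_adm22 D hAdm hRM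
  set B₀' : ℝ := CK * B₃ * (1 + 2 * ((P.d + 2) * P.L : ℕ)) * (1 + 2 * ((P.d + 2) * P.L : ℕ) * (1 + P.L)) with hB₀'
  have hB₀'0 : 0 ≤ B₀' := by positivity
  -- the route's right inverse from P2's rows, with the sup letter AND all twisted letters
  obtain ⟨H, hHinv, hsup, htw⟩ := exists_rightInverse_chartLog_twisted (n := n) k D hDk hAdm hRM w hw H₀ hH₀ dBI hd0 hCK hδ₀ hB₃ hker h162
  have hsup' : ∀ (X : BondIdx D → Matrix n n ℂ) (t : ℝ), 0 ≤ t → (∀ i, ‖X i‖ ≤ t) → ∀ b, w 1 b * ‖H X b‖ ≤ B₀' * t := hsup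
  -- generation 3's chart map on this `H`
  obtain ⟨Dfun, hdiff, hDfun⟩ := exists_chartD_hasFDerivAt k hR'L hM D hDk hAdm hw H hHinv hB₀'0 hsup' hε h18 h2
  -- k0-s1-w2: every (55)+(49) solution family on this `H` is `C^ω`, with holomorphic `fderiv`
  have h55' := fun A' (hA' : ∀ b, w 1 b * ‖A' b‖ < ε) => (hDfun A' hA').1
  have h49' := fun A' (hA' : ∀ b, w 1 b * ‖A' b‖ < ε) => (hDfun A' hA').2.1
  have hω : ContDiffOn ℂ ω Dfun {A' : PBond P 0 → Matrix n n ℂ | ∀ b, w 1 b * ‖A' b‖ < ε} :=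
    contDiffOn_chartD k hR'L hM D hDk hAdm hw H hHinv hB₀'0 hsup' hε h18 h2 Dfun h55' h49'
  have hfd : DifferentiableOn ℂ (fderiv ℂ Dfun) {A' : PBond P 0 → Matrix n n ℂ | ∀ b, w 1 b * ‖A' b‖ < ε} :=
    differentiableOn_fderiv_chartD k hR'L hM D hDk hAdm hw H hHinv hB₀'0 hsup' hε h18 h2 Dfun h55' h49'
  refine ⟨H, Dfun, hHinv, hsup', hdiff, hω, hfd, fun A' hA' => ?_⟩
  obtain ⟨h55, h49, h48, 𝔇, h𝔇, h73⟩ := hDfun A' hA'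
  refine ⟨h55, h49, h48, 𝔇, h𝔇, h73, fun dE dF δ r₀ r₁ r₂ hδ hδh htri hF hE hread hsmall W t ht hW i => ?_⟩
  -- (57): the chart point has weighted size `≤ 2ε`
  have h4 : 4 * C₂ * B₀' * ε ≤ 1 := by
    have h18' : 18 * C₂ * B₀' * ε ≤ 1 := h18
    nlinarith [mul_nonneg (mul_nonneg hC₂ hB₀'0) hε.le]
  have hX₀ : ∀ b, w 1 b * ‖(A' - H (Dfun A')) b‖ ≤ 2 * ε := fun b => by
    have h := size_chartA_le hwpos H hC₂ hB₀'0 hsup' (fun b => (hA' b).le) (h55 ε hε.le fun b => (hA' b).le) b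
    have : B₀' * (4 * C₂ * ε ^ 2) ≤ ε := by nlinarith [mul_nonneg (mul_nonneg hC₂ hB₀'0) hε.le]
    linarith
  have h16 : 16 * ε ≤ Rs := by show 16 * ε ≤ (12800 * (((P.d + 2) * P.L : ℕ) : ℝ) ^ 2 * (P.L : ℝ))⁻¹; linarith
  -- the exponential twists are read-compatible with `κ = e^{δr₀}`
  have hκ : ∀ (idx : BondIdx D) (b : PBond P 0),
      (iterBlockOf (idx.1.1 : ℕ) b.src = idx.1.2.src ∨ iterBlockOf (idx.1.1 : ℕ) b.src = idx.1.2.tgt) →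
      (iterBlockOf (idx.1.1 : ℕ) b.tgt = idx.1.2.src ∨ iterBlockOf (idx.1.1 : ℕ) b.tgt = idx.1.2.tgt) →
      Real.exp (δ * dF idx) ≤ Real.exp (δ * r₀) * Real.exp (δ * dE b) := by
    intro idx b hs ht'
    rw [← Real.exp_add]
    exact Real.exp_le_exp.mpr (by nlinarith [mul_le_mul_of_nonneg_left (hread idx b hs ht') hδ])
  have hBe : 0 ≤ CK * B₃ * (1 + 2 * ((P.d + 2) * P.L : ℕ) * Real.exp (δ * r₁)) * (1 + 2 * ((P.d + 2) * P.L : ℕ) * (1 + P.L) * Real.exp (δ * r₂)) := by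
    positivity
  exact chartD_fderiv_twisted_le k D hDk hcollar hw H hε h16 Dfun (fun A hA => (hDfun A hA).2.1) hA' hX₀ h𝔇
    (fun b => Real.exp (δ * dE b)) (fun c => Real.exp (δ * dF c)) (fun b => Real.exp_pos _) (fun c => Real.exp_pos _) (Real.exp_pos _).le hκ hBe
    (htw dE dF δ r₁ r₂ hδ hδh htri hF hE) hsmall W t ht hW i

/-! ## §2 NODE 00's record, every admissible twist -/

/-- ★★ **[15] PROPOSITION 3 WITH (73)'s DECAY AT NODE 00's RECORD — ANALYTIC EDITION, EVERY TWIST.**  `N07ChartDDecayAtRecord.exists_chartD_decay_T4` verbatim (for every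
`F : T4Family`: thresholds `M_h⁰, R₀`, constants `C_K ≥ 0`, `δ₀ > 0`, `B₃ > 0`; for every admissible nested family `D` of top level `K − n` on NODE 00's torus, every level-weight
family `w`, every `ε` in the window: the right inverse `H` and the chart map `Dfun` with (55), (49), (48), `𝔇`, the norm-level (73) and the twisted (73) for every twist pair with
slacks against the physical `distBI D`), with IN ADDITION the (46) letter of `H`, `ContDiffOn ℂ ω Dfun` and `DifferentiableOn ℂ (fderiv ℂ Dfun)` on the weighted `ε`-ball.
[cite: Balaban1985Variational, (45)-(57) pp.285-287, (68)-(73) pp.288-289, Prop. 3 + remark p.289; Balaban1984PropagatorsII, Cor. 2.8 (2.150)-(2.151) p.249; Balaban1987RG1, (0.1) p.251, (0.4) p.253] -/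
theorem exists_chartD_decay_T4_analytic {ι : Type*} [Fintype ι] [DecidableEq ι] [Nonempty ι] (F : T4Family) :
    ∃ (Mh₀ R₀ : ℕ) (CK δ₀ B₃ : ℝ), 0 ≤ CK ∧ 0 < δ₀ ∧ 0 < B₃ ∧
    ∀ (n K : ℕ) (_ : 1 ≤ K - n) (_ : K - n + 1 ≤ F.m + K) {Mh R a' : ℕ} (_ : Mh = F.L ^ a') (_ : Mh₀ ≤ Mh) (_ : R₀ ≤ R) (_ : 2 * F.L ≤ R)
      (_ : a' + 3 ≤ F.m + n) (D : Domains (F.P K)) (_ : D.k = K - n) (_ : Adm22 D R (F.L * Mh))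
      (w : ℕ → PBond (F.P K) 0 → ℝ) (_ : IsLevWeight (F.P K) (K - n) D w) {ε : ℝ} (_ : 0 < ε)
      (_ : 18 * (960 * ((((F.P K).d + 2) * (F.P K).L : ℕ) : ℝ) * ((F.P K).L : ℝ) / (12800 * ((((F.P K).d + 2) * (F.P K).L : ℕ) : ℝ) ^ 2 * ((F.P K).L : ℝ))⁻¹) *
        (CK * B₃ * (1 + 2 * (((F.P K).d + 2) * (F.P K).L : ℕ)) * (1 + 2 * (((F.P K).d + 2) * (F.P K).L : ℕ) * (1 + (F.P K).L))) * ε ≤ 1)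
      (_ : 64 * ε ≤ (12800 * ((((F.P K).d + 2) * (F.P K).L : ℕ) : ℝ) ^ 2 * ((F.P K).L : ℝ))⁻¹),
      let η : ℝ := (((F.P K).L : ℝ)⁻¹) ^ (K - n)
      let Rs : ℝ := (12800 * ((((F.P K).d + 2) * (F.P K).L : ℕ) : ℝ) ^ 2 * ((F.P K).L : ℝ))⁻¹
      let C₂ : ℝ := 960 * ((((F.P K).d + 2) * (F.P K).L : ℕ) : ℝ) * ((F.P K).L : ℝ) / Rs
      let C₃ : ℝ := 3840 * ((((F.P K).d + 2) * (F.P K).L : ℕ) : ℝ) * ((F.P K).L : ℝ) / Rs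
      let Qlin := (fderiv ℂ (chartLog η D : (PBond (F.P K) 0 → Matrix ι ι ℂ) → BondIdx D → Matrix ι ι ℂ) 0)
      ∃ (H : (BondIdx D → Matrix ι ι ℂ) →ₗ[ℂ] (PBond (F.P K) 0 → Matrix ι ι ℂ)) (Dfun : (PBond (F.P K) 0 → Matrix ι ι ℂ) → (BondIdx D → Matrix ι ι ℂ)),
        (∀ X, Qlin (H X) = X) ∧
        (∀ (X : BondIdx D → Matrix ι ι ℂ) (t : ℝ), 0 ≤ t → (∀ i, ‖X i‖ ≤ t) → ∀ b,
          w 1 b * ‖H X b‖ ≤ CK * B₃ * (1 + 2 * (((F.P K).d + 2) * (F.P K).L : ℕ)) * (1 + 2 * (((F.P K).d + 2) * (F.P K).L : ℕ) * (1 + (F.P K).L)) * t) ∧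
        DifferentiableOn ℂ Dfun {A' : PBond (F.P K) 0 → Matrix ι ι ℂ | ∀ b, w 1 b * ‖A' b‖ < ε} ∧
        ContDiffOn ℂ ω Dfun {A' : PBond (F.P K) 0 → Matrix ι ι ℂ | ∀ b, w 1 b * ‖A' b‖ < ε} ∧
        DifferentiableOn ℂ (fderiv ℂ Dfun) {A' : PBond (F.P K) 0 → Matrix ι ι ℂ | ∀ b, w 1 b * ‖A' b‖ < ε} ∧
        ∀ A' : PBond (F.P K) 0 → Matrix ι ι ℂ, (∀ b, w 1 b * ‖A' b‖ < ε) →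
          (∀ (ρ : ℝ), 0 ≤ ρ → (∀ b, w 1 b * ‖A' b‖ ≤ ρ) → ∀ i, ‖Dfun A' i‖ ≤ 4 * C₂ * ρ ^ 2) ∧
          chartLog η D (A' - H (Dfun A')) - Qlin (A' - H (Dfun A')) = Dfun A' ∧
          chartLog η D (A' - H (Dfun A')) = Qlin A' ∧
          ∃ 𝔇 : (PBond (F.P K) 0 → Matrix ι ι ℂ) →L[ℂ] (BondIdx D → Matrix ι ι ℂ), HasFDerivAt Dfun 𝔇 A' ∧
            (∀ (W : PBond (F.P K) 0 → Matrix ι ι ℂ) (t : ℝ), 0 ≤ t → (∀ b, w 1 b * ‖W b‖ ≤ t) → ∀ i, ‖𝔇 W i‖ ≤ 4 * C₃ * ε * t) ∧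
            ∀ (dE : PBond (F.P K) 0 → ℝ) (dF : BondIdx D → ℝ) (δ r₀ r₁ r₂ : ℝ), 0 ≤ δ → δ ≤ δ₀ / 2 →
              (∀ b c, dE b ≤ distBI D b c + dF c) →
              (∀ (i c : BondIdx D) (x : Site (F.P K) 0),
                (iterBlockOf (i.1.1 : ℕ) x = i.1.2.src ∨ iterBlockOf (i.1.1 : ℕ) x = i.1.2.tgt) →
                (iterBlockOf (c.1.1 : ℕ) x = c.1.2.src ∨ iterBlockOf (c.1.1 : ℕ) x = c.1.2.tgt) → dF i ≤ dF c + r₁) →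
              (∀ (b b' : PBond (F.P K) 0) (x : Site (F.P K) 0) (j : ℕ), (x = b.src ∨ x = b.tgt) → j ≤ D.k →
                iterBlockOf j b'.src = iterBlockOf j x → dE b ≤ dE b' + r₂) →
              (∀ (idx : BondIdx D) (b : PBond (F.P K) 0),
                (iterBlockOf (idx.1.1 : ℕ) b.src = idx.1.2.src ∨ iterBlockOf (idx.1.1 : ℕ) b.src = idx.1.2.tgt) →
                (iterBlockOf (idx.1.1 : ℕ) b.tgt = idx.1.2.src ∨ iterBlockOf (idx.1.1 : ℕ) b.tgt = idx.1.2.tgt) → dF idx ≤ dE b + r₀) →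
              4 * C₃ * Real.exp (δ * r₀) *
                  (CK * B₃ * (1 + 2 * (((F.P K).d + 2) * (F.P K).L : ℕ) * Real.exp (δ * r₁)) *
                    (1 + 2 * (((F.P K).d + 2) * (F.P K).L : ℕ) * (1 + (F.P K).L) * Real.exp (δ * r₂))) * ε ≤ 1 →
              ∀ (W : PBond (F.P K) 0 → Matrix ι ι ℂ) (t : ℝ), 0 ≤ t → (∀ b, Real.exp (δ * dE b) * (w 1 b * ‖W b‖) ≤ t) →
                ∀ i, Real.exp (δ * dF i) * ‖𝔇 W i‖ ≤ 4 * C₃ * Real.exp (δ * r₀) * ε * t := by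
  obtain ⟨Mh₀, R₀, CK, δ₀, B₃, CG, hCK, hδ₀, hB₃, -, hmain⟩ := kernelRowsAt_of_adm22_T4 F
  refine ⟨Mh₀, R₀, CK, δ₀, B₃, hCK, hδ₀, hB₃, ?_⟩
  intro n K hk1 hk' Mh R a' hMha hMh hR h2L hsize D hDk hAdm w hw ε hε h18 h2 η Rs C₂ C₃ Qlin
  -- P2's rows at this family: a distance `dBI ≥ distBI` with (162) and the kernel rows of `flatH`
  obtain ⟨⟨dBI, hdist, h162, hker⟩, -⟩ := hmain n K hk1 hk' hMha hMh hR hsize D hDk hAdm w hw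
  have hd0 : ∀ b c, 0 ≤ dBI b c := fun b c => (distBI_nonneg D b c).trans (hdist b c)
  have hL1 : 1 ≤ F.L := by have := F.hL11; omega
  have hM : 1 ≤ F.L * Mh := by
    rw [hMha]; exact Nat.one_le_iff_ne_zero.mpr (Nat.mul_ne_zero (by omega) (pow_ne_zero _ (by omega)))
  obtain ⟨H, Dfun, hHinv, hsup, hdiff, hω, hfd, hDfun⟩ := exists_chartD_decay_of_kernelRows_analytic (n := ι) (K - n) h2L hM D hDk hAdm hw
    (flatH (F.P K) (K - n) D) (isFlatH_flatH (F.P K) (K - n) D) dBI hd0 hCK hδ₀.le hB₃.le hker h162 hε h18 h2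
  refine ⟨H, Dfun, hHinv, hsup, hdiff, hω, hfd, fun A' hA' => ?_⟩
  obtain ⟨h55, h49, h48, 𝔇, h𝔇, h73, htw⟩ := hDfun A' hA'
  refine ⟨h55, h49, h48, 𝔇, h𝔇, h73, fun dE dF δ r₀ r₁ r₂ hδ hδh htri hF hE hread hsmall W t ht hW i => ?_⟩
  exact htw dE dF δ r₀ r₁ r₂ hδ hδh (fun b c => (htri b c).trans (by linarith [hdist b c])) hF hE hread hsmall W t ht hW i

/-! ## §3 NODE 00's record, print's kernel shape: the entries `𝔇(δ_b·a)(j,c)` decay exponentially, for a `Dfun` with holomorphic `fderiv` -/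

/-- ★★★ **THE KERNEL ENTRIES OF `𝔇 = δD(A′)∕δA′` AT NODE 00's RECORD DECAY EXPONENTIALLY — ANALYTIC EDITION.**  `N07ChartDDecayRefBond.exists_chartD_kernelEntry_decay_T4` verbatim
— for every `F : T4Family`, record data and `ε` in the window: `H`, `Dfun` with (55), (49), (48), `𝔇`, the norm-level (73), and for every fine bond `b`, matrix `a`, rate
`0 ≤ δ ≤ ½δ₀` in the `δ`-window, every index bond `(j,c)`: **`‖𝔇(δ_b·a)(j,c)‖ ≤ 4C₃ε·e^{2δ}·(w₁(b)‖a‖)·e^{−δ·distBI D b (j,c)}`** — with IN ADDITION the (46) letter of `H`,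
`ContDiffOn ℂ ω Dfun` and `DifferentiableOn ℂ (fderiv ℂ Dfun)` on the weighted `ε`-ball (the data the p. 289 remark on `𝔇₂` consumes).  §2 fed with the canonical twist
«scaled distance to `b`» (the four slacks `refTwist_*` of `N07ChartDDecayRefBond`) on the unit direction `δ_b·a`.
[cite: Balaban1985Variational, (66) p.288, (73) p.289, Prop. 3 + remark p.289, (85)-(86) p.291, (161) p.303; Balaban1984PropagatorsII, (2.46) p.231, (2.54) p.233] -/
theorem exists_chartD_kernelEntry_decay_T4_analytic {ι : Type*} [Fintype ι] [DecidableEq ι] [Nonempty ι] (F : T4Family) :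
    ∃ (Mh₀ R₀ : ℕ) (CK δ₀ B₃ : ℝ), 0 ≤ CK ∧ 0 < δ₀ ∧ 0 < B₃ ∧
    ∀ (n K : ℕ) (_ : 1 ≤ K - n) (_ : K - n + 1 ≤ F.m + K) {Mh R a' : ℕ} (_ : Mh = F.L ^ a') (_ : Mh₀ ≤ Mh) (_ : R₀ ≤ R) (_ : 2 * F.L ≤ R)
      (_ : a' + 3 ≤ F.m + n) (D : Domains (F.P K)) (_ : D.k = K - n) (_ : Adm22 D R (F.L * Mh))
      (w : ℕ → PBond (F.P K) 0 → ℝ) (_ : IsLevWeight (F.P K) (K - n) D w) {ε : ℝ} (_ : 0 < ε)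
      (_ : 18 * (960 * ((((F.P K).d + 2) * (F.P K).L : ℕ) : ℝ) * ((F.P K).L : ℝ) / (12800 * ((((F.P K).d + 2) * (F.P K).L : ℕ) : ℝ) ^ 2 * ((F.P K).L : ℝ))⁻¹) *
        (CK * B₃ * (1 + 2 * (((F.P K).d + 2) * (F.P K).L : ℕ)) * (1 + 2 * (((F.P K).d + 2) * (F.P K).L : ℕ) * (1 + (F.P K).L))) * ε ≤ 1)
      (_ : 64 * ε ≤ (12800 * ((((F.P K).d + 2) * (F.P K).L : ℕ) : ℝ) ^ 2 * ((F.P K).L : ℝ))⁻¹),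
      let η : ℝ := (((F.P K).L : ℝ)⁻¹) ^ (K - n)
      let Rs : ℝ := (12800 * ((((F.P K).d + 2) * (F.P K).L : ℕ) : ℝ) ^ 2 * ((F.P K).L : ℝ))⁻¹
      let C₂ : ℝ := 960 * ((((F.P K).d + 2) * (F.P K).L : ℕ) : ℝ) * ((F.P K).L : ℝ) / Rs
      let C₃ : ℝ := 3840 * ((((F.P K).d + 2) * (F.P K).L : ℕ) : ℝ) * ((F.P K).L : ℝ) / Rs
      let Qlin := (fderiv ℂ (chartLog η D : (PBond (F.P K) 0 → Matrix ι ι ℂ) → BondIdx D → Matrix ι ι ℂ) 0)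
      ∃ (H : (BondIdx D → Matrix ι ι ℂ) →ₗ[ℂ] (PBond (F.P K) 0 → Matrix ι ι ℂ)) (Dfun : (PBond (F.P K) 0 → Matrix ι ι ℂ) → (BondIdx D → Matrix ι ι ℂ)),
        (∀ X, Qlin (H X) = X) ∧
        (∀ (X : BondIdx D → Matrix ι ι ℂ) (t : ℝ), 0 ≤ t → (∀ i, ‖X i‖ ≤ t) → ∀ b,
          w 1 b * ‖H X b‖ ≤ CK * B₃ * (1 + 2 * (((F.P K).d + 2) * (F.P K).L : ℕ)) * (1 + 2 * (((F.P K).d + 2) * (F.P K).L : ℕ) * (1 + (F.P K).L)) * t) ∧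
        DifferentiableOn ℂ Dfun {A' : PBond (F.P K) 0 → Matrix ι ι ℂ | ∀ b, w 1 b * ‖A' b‖ < ε} ∧
        ContDiffOn ℂ ω Dfun {A' : PBond (F.P K) 0 → Matrix ι ι ℂ | ∀ b, w 1 b * ‖A' b‖ < ε} ∧
        DifferentiableOn ℂ (fderiv ℂ Dfun) {A' : PBond (F.P K) 0 → Matrix ι ι ℂ | ∀ b, w 1 b * ‖A' b‖ < ε} ∧
        ∀ A' : PBond (F.P K) 0 → Matrix ι ι ℂ, (∀ b, w 1 b * ‖A' b‖ < ε) →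
          (∀ (ρ : ℝ), 0 ≤ ρ → (∀ b, w 1 b * ‖A' b‖ ≤ ρ) → ∀ i, ‖Dfun A' i‖ ≤ 4 * C₂ * ρ ^ 2) ∧
          chartLog η D (A' - H (Dfun A')) - Qlin (A' - H (Dfun A')) = Dfun A' ∧
          chartLog η D (A' - H (Dfun A')) = Qlin A' ∧
          ∃ 𝔇 : (PBond (F.P K) 0 → Matrix ι ι ℂ) →L[ℂ] (BondIdx D → Matrix ι ι ℂ), HasFDerivAt Dfun 𝔇 A' ∧
            (∀ (W : PBond (F.P K) 0 → Matrix ι ι ℂ) (t : ℝ), 0 ≤ t → (∀ b, w 1 b * ‖W b‖ ≤ t) → ∀ i, ‖𝔇 W i‖ ≤ 4 * C₃ * ε * t) ∧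
            ∀ (b : PBond (F.P K) 0) (a : Matrix ι ι ℂ) (δ : ℝ), 0 ≤ δ → δ ≤ δ₀ / 2 →
              4 * C₃ * Real.exp (δ * 3) *
                  (CK * B₃ * (1 + 2 * (((F.P K).d + 2) * (F.P K).L : ℕ) * Real.exp (δ * 4)) *
                    (1 + 2 * (((F.P K).d + 2) * (F.P K).L : ℕ) * (1 + (F.P K).L) * Real.exp (δ * 1))) * ε ≤ 1 →
              ∀ i, ‖𝔇 (Pi.single b a) i‖ ≤ 4 * C₃ * ε * Real.exp (δ * 2) * (w 1 b * ‖a‖) * Real.exp (-(δ * distBI D b i)) := by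
  classical
  obtain ⟨Mh₀, R₀, CK, δ₀, B₃, hCK, hδ₀, hB₃, hmain⟩ := exists_chartD_decay_T4_analytic (ι := ι) F
  refine ⟨Mh₀, R₀, CK, δ₀, B₃, hCK, hδ₀, hB₃, ?_⟩
  intro n K hk1 hk' Mh R a' hMha hMh hR h2L hsize D hDk hAdm w hw ε hε h18 h2 η Rs C₂ C₃ Qlin
  obtain ⟨H, Dfun, hHinv, hsup, hdiff, hω, hfd, hDfun⟩ := hmain n K hk1 hk' hMha hMh hR h2L hsize D hDk hAdm w hw hε h18 h2
  refine ⟨H, Dfun, hHinv, hsup, hdiff, hω, hfd, fun A' hA' => ?_⟩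
  obtain ⟨h55, h49, h48, 𝔇, h𝔇, h73, htw⟩ := hDfun A' hA'
  refine ⟨h55, h49, h48, 𝔇, h𝔇, h73, fun b a δ hδ hδh hsmall i => ?_⟩
  have hwnn : ∀ b', 0 ≤ w 1 b' := levWeight_nonneg hw 1
  -- the canonical twist «scaled distance to `b`»: `dE(b′) = L^{−k}dist₀(b′₋, b₋) − 1`, `dF(c) = distBI D b c`; the unit direction has twisted size `≤ e^{−δ}·w₁(b)‖a‖`
  have hWe : ∀ b' : PBond (F.P K) 0,
      Real.exp (δ * ((((F.P K).L : ℝ)⁻¹) ^ D.k * distSite (Mk (F.P K) 0) b'.src b.src - 1)) *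
        (w 1 b' * ‖(Pi.single b a : PBond (F.P K) 0 → Matrix ι ι ℂ) b'‖) ≤ Real.exp (δ * (0 - 1)) * (w 1 b * ‖a‖) := by
    intro b'
    by_cases hb' : b' = b
    · subst hb'; rw [Pi.single_eq_same, distSite_self, mul_zero]
    · rw [Pi.single_eq_of_ne (M := fun _ : PBond (F.P K) 0 => Matrix ι ι ℂ) hb', norm_zero, mul_zero, mul_zero]
      exact mul_nonneg (Real.exp_pos _).le (mul_nonneg (hwnn b) (norm_nonneg a))
  have h := htw (fun b' => (((F.P K).L : ℝ)⁻¹) ^ D.k * distSite (Mk (F.P K) 0) b'.src b.src - 1) (fun c => distBI D b c) δ 3 4 1 hδ hδh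
    (fun b' c => refTwist_triangle D b b' c) (fun i' c x hi hc => refTwist_index_slack D b i' c x hi hc)
    (fun b₁ b₂ x j hx hj hblk => refTwist_block_slack D b b₁ b₂ x j hx hj hblk) (fun idx b' hs _ => refTwist_read_slack D b idx b' hs)
    hsmall (Pi.single b a) (Real.exp (δ * (0 - 1)) * (w 1 b * ‖a‖)) (mul_nonneg (Real.exp_pos _).le (mul_nonneg (hwnn b) (norm_nonneg a))) hWe i
  -- divide by the twist at `i` and collect the exponentials
  have hi : 0 < Real.exp (δ * distBI D b i) := Real.exp_pos _
  rw [Real.exp_neg, ← div_eq_mul_inv, le_div_iff₀ hi, mul_comm]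
  calc Real.exp (δ * distBI D b i) * ‖𝔇 (Pi.single b a) i‖ ≤ 4 * C₃ * Real.exp (δ * 3) * ε * (Real.exp (δ * (0 - 1)) * (w 1 b * ‖a‖)) := h
    _ = 4 * C₃ * ε * (Real.exp (δ * 3) * Real.exp (δ * (0 - 1))) * (w 1 b * ‖a‖) := by ring
    _ = 4 * C₃ * ε * Real.exp (δ * 2) * (w 1 b * ‖a‖) := by rw [← Real.exp_add]; ring_nf

end Summit.QuantumFields.YangMills.BalabanUVNodes.N07ChartDDecayAnalytic

end
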